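import Summits.BirchSwinnertonDyer.Rank1Residual.Additive.XGordRankZeroOneCyclotomicThree
import Summits.BirchSwinnertonDyer.Rank1Residual.Additive.CyclotomicThreeReduction
import Summits.BirchSwinnertonDyer.Rank1Residual.Additive.TwistRamTransport
import Literature.NumberTheory.EllipticCurves.Greenberg1999.LeadingTermRankOneQuadraticBaseChange
import Literature.NumberTheory.EllipticCurves.Wuthrich2014.ReducibleDivisibilityCyclotomicThree
import Literature.NumberTheory.EllipticCurves.Kato2004.BigImageDivisibilityCyclotomicThree
import Literature.NumberTheory.EllipticCurves.Rank1Residual.Typed.CasselsLowerBound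
import HarnessLib

/-!
# Ranks `(0,1)` at `p = 3`, FROM NAMED FACTS ONLY: X3 (Wuthrich Thm. 16) and X4 (Kato Thm. 17.4 (3))
# with twist `V = W^{(−3)}` good ordinary of analytic rank `1` (line V17, corollaries + census)

HONEST FRAMING (cell `b2b-bsdres`, run/shared/lean/b2b/bsd-rank1-residual/, verbatim in every
file): the goal of the cell is to DELETE the COMBINATION-SHAPED residual classes of the
Birch–Swinnerton-Dyer formula for ALL analytic-rank `≤ 1` elliptic curves over `ℚ` — "full BSD
formula for every rank `≤ 1` curve in class `C`" assembled STRICTLY from published theorems — so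
that the rank-`≤ 1` remainder becomes exactly the CONSTRUCTION-SHAPED classes, which are TYPED
(missing-input `Prop`s), NOT attempted. This is not "finishing BSD". Seat additive-p4, gen 7
(research route on X3/X4); labels UNCHANGED (X3, X4, and X1/X10 for the twist pair `(V,3)`); nothing
is booked here (the referee rules).

Theorems only (no `def`, no `sorry`, no new named fact). The inline hypotheses of the core
`XGordRankZeroOneCyclotomicThree.exists_padicVal_shaOrder_add_le` are DERIVED from named facts:
* `hS1K` ⟸ **`Greenberg1999.schneider_charCoeff_rankOne_quadraticBaseChange`** (Greenberg LNM 1716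
  p. 110 = Schneider 1985 in rank one over a quadratic field, reading-fact of this generation,
  flags `Gr99-p110-rankone-display` / `Gr99-p110-height-functoriality`) + the `K`-side reduction data of
  `CyclotomicThreeReduction` (`{v ∣ 3} = {𝔭}`, `#Ẽ_𝔭(k_𝔭)[3^∞] = #V(𝔽₃)[3^∞]`, `a_𝔭 = a₃`):
  `XGordRankZeroOneCyclotomicThree.schneiderK_of_fact`;
* `hW16K` ⟸ Wuthrich 2014 Thm. 16 over `ℚ(ζ₃)` (`hW16`, A92) for X3 (`V[3]` reducible), resp. Kato
  Astérisque 295 Thm. 17.4 (3) over `ℚ(ζ₃)` (`hKato`, A99) for X4 (`ρ_{V,3^∞}` onto ⟸ census bits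
  `surj(3) ∧ ram(3)` of `W`, `TwistRamTransport`);
* the canonical `3`-adic height `Dh` ⟸ `mazur_tate_sigma_exists_odd` (`hMT`, as in x1b's rank-one engine);
* Perrin-Riou 1987 at odd `p` (`hPR`), Milne 1972 (`hMilne`), modularity (`hmod`, `hmodD`), GZK (`hGZK`).
Per row: the twist datum `C • V^{(−3)} = W`, `V` good ordinary at `3`, `W` additive, `r_an(V) = 1`,
`r_an(W) = 0`, the CERTIFICATE `[T¹]L₃(f_V, α) ≠ 0` for the newform of `V` (`hcert`), the unit bits.

Census (hyp two-engine table `b2b-bsdres-hyp/hyp/cyc3/cyc3_two_engine.tsv`, `N < 2·10⁴`, engine A =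
ENGINE P3c row for row): (G-ord, `e = 2`) ∧ `p = 3` ∧ `(r_an(W), r_an(V)) = (0,1)`: **149 CORE-open
rows — X3 74 (73 doubly-unit + 1 with `3 ∣ #Ш_an(W)`), X4 75 (68 doubly-unit with `surj(3) ∧ ram(3)`,
2 with `3 ∣ #Ш_an(W)`, 5 without a `ram` prime); `3 ∤ #Ш_an(V)` on all 149**. So, modulo the named
facts and ONE `3`-adic certificate per row (`[T¹]L₃(f_V,α) ≠ 0`, requested from the iw seats), 141 rows
reach `BSD₃(W) ∧ BSD₃(V)` — the additive rank-`0` pair `(W,3)` AND its rank-ONE twist pair `(V,3)` (an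
X1 `r = 1` pair when `V[3]` is reducible, an X10-type pair when irreducible) — and 3 more the typed
upper half for `W`. Labels UNCHANGED; nothing booked.
-/

noncomputable section

open scoped Classical MatrixGroups ModularForm

open CongruenceSubgroup WeierstrassCurve NumberField IsDedekindDomain
  Literature.NumberTheory.EllipticCurves Literature.NumberTheory.EllipticCurves.ModularForms
  Literature.NumberTheory.EllipticCurves.Rank1Residual
  Literature.NumberTheory.EllipticCurves.Rank1Residual.Typed
  Literature.NumberTheory.GaloisRepresentations

namespace Summit.BirchSwinnertonDyer.Rank1Residual.Additive

/-! ## §1 `hS1K` from Greenberg p. 110 over number fields -/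

section SchneiderK

variable (K : Type) [Field K] [NumberField K] [IsCyclotomicExtension {3} ℚ K]
  (V : WeierstrassCurve ℚ) [V.IsElliptic] [V.IsGloballyMinimal]

/-- **Greenberg p. 110 (Schneider's rank-one leading term) for `V_K`, `K = ℚ(ζ₃)`, in the `K`-shape of
line V17** (the inline hypothesis `hS1K` of `XGordRankZeroOneCyclotomicThree.exists_padicVal_shaOrder_add_le`),
DERIVED from the named fact `Greenberg1999.schneider_charCoeff_rankOne_quadraticBaseChange`: the only
prime of `K` above `3` is `𝔭 = (ζ₃ − 1)` with `k_𝔭 = 𝔽₃`, `V_K` has good ordinary reduction there with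
`a_𝔭(V_K) = a₃(V)`, and `#Ẽ_𝔭(𝔽₃)[3^∞] = #V(𝔽₃)[3^∞]` (`CyclotomicThreeReduction`).
[cite: GreenbergLNM1716, §4 p. 110] -/
theorem XGordRankZeroOneCyclotomicThree.schneiderK_of_fact
    (hS1 : Greenberg1999.schneider_charCoeff_rankOne_quadraticBaseChange) (hord : IsOrdinaryAt V 3) :
    ∀ (κ : ZpExtension K 3) (γ : Field.absoluteGaloisGroup K),
      κ.IsCyclotomic → κ.IsTopGenerator γ →
      (∃ ζ : ℤ_[3]ˣ, IsOfFinOrder ζ ∧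
        ((GaloisRep.cyclotomicCharacter K 3 γ * ζ : ℤ_[3]ˣ) : ℤ_[3]) = (cyclotomicGenerator 3 : ℤ_[3])) →
      ∀ (D : (V.baseChange K).SelmerDualData κ γ) [Module.Finite (IwasawaAlgebra 3) D.X], D.IsTorsion →
      ∀ (fE : IwasawaAlgebra 3), D.charIdeal = Ideal.span {fE} →
        (V.baseChange K).mordellWeilRank = 1 →
        Finite (AddCommGroup.primaryComponent (V.baseChange K).sha 3) →
      ∀ (Q : (V.baseChange K).toAffine.Point), IsMordellWeilBasis (fun _ : Fin 1 => Q) →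
      ∀ (Dh : PAdicHeightData V 3), Dh.IsCanonical →
        PowerSeries.X ∣ fE ∧
        ∃ DK : PAdicHeightDataK V 3 K, DK.RestrictsTo Dh ∧
          ∃ u : ℤ_[3]ˣ,
            ((PowerSeries.coeff 1 fE : ℤ_[3]) : ℚ_[3]) * padicLog 3 (cyclotomicGenerator 3) *
                (Nat.card (AddCommGroup.primaryComponent (V.baseChange K).toAffine.Point 3) : ℚ_[3]) ^ 2 =
              ((u : ℤ_[3]) : ℚ_[3]) * DK.pairing Q Q *
                (3 : ℚ_[3]) ^ (padicValNat 3 (V.baseChange K).tamagawaProduct) *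
                (Nat.card (AddCommGroup.primaryComponent
                  ((integralModelInt V).map (Int.castRingHom (ZMod 3))).toAffine.Point 3) : ℚ_[3]) ^ 2 *
                (Nat.card (AddCommGroup.primaryComponent (V.baseChange K).sha 3) : ℚ_[3]) := by
  intro κ γ hκ hγ hγ' D _ hX fE hfE hrank hfin Q hQ Dh hDh
  haveI : (V.baseChange K).IsElliptic := by rw [WeierstrassCurve.baseChange]; infer_instance
  have h2 : Module.finrank ℚ K = 2 := finrank_eq_two_of_isCyclotomicExtension_three (K := K)
  obtain ⟨𝔭, h3, hS, hN⟩ := exists_prime_over_three K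
  have hΔ : ¬ (3 : ℤ) ∣ minimalDiscriminantInt V := fun hdvd ↦
    V.not_hasGoodReductionAtPrime_of_dvd_minimalDiscriminantInt 3 hdvd hord.1
  have hall : ∀ v : HeightOneSpectrum (𝓞 K), ((3 : ℕ) : 𝓞 K) ∈ v.asIdeal →
      (V.baseChange K).HasGoodReductionAt v ∧ ¬ ((3 : ℕ) : ℤ) ∣ (V.baseChange K).frobeniusTraceAt v := by
    intro v hv
    have hv' : v ∈ ({v : HeightOneSpectrum (𝓞 K) | ((3 : ℕ) : 𝓞 K) ∈ v.asIdeal} : Set _) := hv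
    rw [hS, Set.mem_singleton_iff] at hv'
    subst hv'
    refine ⟨(isMinimalAt_and_hasGoodReductionAt_baseChange_of_mem V (p := 3) (by exact_mod_cast hΔ) v h3).2, ?_⟩
    rw [frobeniusTraceAt_baseChange_eq_frobeniusTrace_three V v h3 hN hΔ]
    exact hord.2
  obtain ⟨hXdvd, DK, hres, u, hu⟩ := hS1 V K h2 3 (by norm_num) hall κ γ hκ hγ hγ' D hX fE hfE hrank hfin
    Q hQ Dh hDh
  refine ⟨hXdvd, DK, hres, u, ?_⟩
  rw [hu, hS, finprod_mem_singleton, natCard_primaryComponent_point_reductionAt_eq V 𝔭 h3 hN hΔ, Nat.cast_ofNat]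

end SchneiderK

/-! ## §2 X3 (Wuthrich Thm. 16) and X4 (Kato Thm. 17.4 (3)) from named facts only -/

section Facts

variable (V : WeierstrassCurve ℚ) [V.IsElliptic] [V.IsGloballyMinimal]
  (W : WeierstrassCurve ℚ) [W.IsElliptic] [W.IsGloballyMinimal]

/-- **Line V17 for X3, FROM NAMED FACTS ONLY.** Let `V/ℚ` be globally minimal, good ordinary at `3`
with `V[3]` REDUCIBLE, of analytic rank `1`, and `W = C • V^{(−3)}` globally minimal ADDITIVE at `3`
(the X3 ∧ (G-ord, `e = 2`) situation) of analytic rank `0`; assume the certificate `[T¹]L₃(f,α) ≠ 0` for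
the newform(s) of `V` (`hcert`). Then `#Ш_an(V) = q_V`, `#Ш_an(W) = q_W` are rationals with
**`ord₃ #Ш(V) + ord₃ #Ш(W) ≤ ord₃ q_V + ord₃ q_W`**, granted EXACTLY: Wuthrich 2014 Thm. 16 over `ℚ(ζ₃)`
(`hW16`), Greenberg p. 110 / Schneider 1985 over `ℚ(ζ₃)` (`hS1`), Perrin-Riou 1987 (`hPR`), the
Mazur–Tate sigma function at odd `p` (`hMT`, existence of THE canonical `3`-adic height), Milne 1972
(`hMilne`), modularity (`hmod`, `hmodD`), Gross–Zagier–Kolyvagin (`hGZK`).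
[cite: Wuthrich2014, Thm. 16 (p. 397)] [cite: GreenbergLNM1716, §4 p. 110] [cite: PerrinRiou1987, §1.4 Cor. 1.8]
[cite: Milne1972ArithmeticAV, §1 Thm. 1] -/
theorem X3GordRankZeroOneCyclotomicThree.exists_padicVal_shaOrder_add_le_of_facts
    (hW16 : Wuthrich2014.charIdeal_dvd_padicLFunction_cyclotomicThree)
    (hS1 : Greenberg1999.schneider_charCoeff_rankOne_quadraticBaseChange)
    (hPR : perrinRiou_rankOne_leadingTerms_odd) (hMT : mazur_tate_sigma_exists_odd)
    (hMilne : Milne1972.bsdQuotient_baseChange_quadratic_anyModel)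
    (hGZK : rank_eq_analyticRank_of_analyticRank_le_one) (hmod : hasEntireLFunction_rat)
    (hmodD : nonempty_modularParametrizationData)
    (C : VariableChange ℚ) (hC : C • V.quadraticTwist (-(3 : ℚ)) = W)
    (hord : IsOrdinaryAt V 3) (hred : ¬ V.HasIrreducibleModPGaloisRep 3) (hadd : Addv W 3)
    (hrV : V.analyticRank = 1) (hrW : W.analyticRank = 0)
    (hcert : ∀ {N : ℕ} [NeZero N] (f : CuspForm (Gamma0 N) 2), IsNewformOf V f →
      PowerSeries.coeff 1 (padicLFunction f ((unitRoot V 3 : ℤ_[3]) : ℚ_[3])) ≠ 0) :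
    ∃ qV qW : ℚ, shaAn V = (qV : ℂ) ∧ shaAn W = (qW : ℂ) ∧
      (padicValNat 3 V.shaOrder : ℤ) + padicValNat 3 W.shaOrder ≤ padicValRat 3 qV + padicValRat 3 qW := by
  haveI : IsCyclotomicExtension {3} ℚ (CyclotomicField 3 ℚ) := CyclotomicField.isCyclotomicExtension 3 ℚ
  set K := CyclotomicField 3 ℚ
  haveI : NeZero (V.conductorNorm ℤ) := ⟨(V.conductorNorm_pos_holds).ne'⟩
  obtain ⟨Dm⟩ := hmodD V
  have hf : IsNewformOf V Dm.f := Dm.isNewformOf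
  obtain ⟨ϖ, -, hϖ, -⟩ := Dm.exists_rat_mul_realPeriodRat_eq_plusPeriod
  obtain ⟨ϖ', -, hϖ'⟩ := exists_rat_mul_imaginaryPeriodRat_eq_minusPeriod Dm
  obtain ⟨Dh, hDh⟩ := exists_isCanonical_of_odd hMT V 3 (by norm_num) hord.1 hord.2
  refine XGordRankZeroOneCyclotomicThree.exists_padicVal_shaOrder_add_le K V W hPR hGZK hmod hMilne C hC
    hord hadd hrV hrW hf ϖ ϖ' hϖ hϖ' Dh hDh (hcert Dm.f hf) (fun κ γ hκ hγ hγ' D ↦ ?_)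
    (XGordRankZeroOneCyclotomicThree.schneiderK_of_fact K V hS1 hord)
  exact hW16 V K (V.baseChange K) hord hred ⟨1, one_smul _ _⟩ hκ hγ hγ' hf D ϖ ϖ' hϖ hϖ'

/-- **Line V17 for X4, FROM NAMED FACTS ONLY.** As `X3GordRankZeroOneCyclotomicThree…_of_facts`, with
`ρ_{V,3^∞}` onto in place of reducibility — supplied by the census bits `surj(3) ∧ ram(3)` of `W`
(`forall_surj_pow_of_twist_pStar_of_surj_of_ram`) — and Kato Astérisque 295 Thm. 17.4 (3) over `ℚ(ζ₃)`
(`hKato`) in place of Wuthrich Thm. 16.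
[cite: Kato2004Asterisque, Thm. 17.4 (3) (p. 273)] [cite: GreenbergLNM1716, §4 p. 110]
[cite: PerrinRiou1987, §1.4 Cor. 1.8] [cite: Milne1972ArithmeticAV, §1 Thm. 1] -/
theorem X4GordRankZeroOneCyclotomicThree.exists_padicVal_shaOrder_add_le_of_surj_of_ram
    (hKato : Kato2004.charIdeal_dvd_padicLFunction_cyclotomicThree_of_surjective)
    (hS1 : Greenberg1999.schneider_charCoeff_rankOne_quadraticBaseChange)
    (hPR : perrinRiou_rankOne_leadingTerms_odd) (hMT : mazur_tate_sigma_exists_odd)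
    (hMilne : Milne1972.bsdQuotient_baseChange_quadratic_anyModel)
    (hGZK : rank_eq_analyticRank_of_analyticRank_le_one) (hmod : hasEntireLFunction_rat)
    (hmodD : nonempty_modularParametrizationData)
    (C : VariableChange ℚ) (hC : C • V.quadraticTwist (-(3 : ℚ)) = W)
    (hord : IsOrdinaryAt V 3) (hsurj : Surj W 3) (hram : Ram W 3) (hadd : Addv W 3)
    (hrV : V.analyticRank = 1) (hrW : W.analyticRank = 0)
    (hcert : ∀ {N : ℕ} [NeZero N] (f : CuspForm (Gamma0 N) 2), IsNewformOf V f →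
      PowerSeries.coeff 1 (padicLFunction f ((unitRoot V 3 : ℤ_[3]) : ℚ_[3])) ≠ 0) :
    ∃ qV qW : ℚ, shaAn V = (qV : ℂ) ∧ shaAn W = (qW : ℂ) ∧
      (padicValNat 3 V.shaOrder : ℤ) + padicValNat 3 W.shaOrder ≤ padicValRat 3 qV + padicValRat 3 qW := by
  haveI : IsCyclotomicExtension {3} ℚ (CyclotomicField 3 ℚ) := CyclotomicField.isCyclotomicExtension 3 ℚ
  set K := CyclotomicField 3 ℚ
  haveI : NeZero (V.conductorNorm ℤ) := ⟨(V.conductorNorm_pos_holds).ne'⟩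
  obtain ⟨Dm⟩ := hmodD V
  have hf : IsNewformOf V Dm.f := Dm.isNewformOf
  obtain ⟨ϖ, -, hϖ, -⟩ := Dm.exists_rat_mul_realPeriodRat_eq_plusPeriod
  obtain ⟨ϖ', -, hϖ'⟩ := exists_rat_mul_imaginaryPeriodRat_eq_minusPeriod Dm
  obtain ⟨Dh, hDh⟩ := exists_isCanonical_of_odd hMT V 3 (by norm_num) hord.1 hord.2
  have hC' : C • V.quadraticTwist (((-((3 : ℕ) : ℤ)) : ℤ) : ℚ) = W := by push_cast; exact hC
  have hsurjV : ∀ n : ℕ, V.HasSurjectiveModNGaloisRep (3 ^ n : ℕ) :=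
    forall_surj_pow_of_twist_pStar_of_surj_of_ram 3 V (k := -1) (by norm_num) (Or.inr rfl) C hC' hsurj hram
  refine XGordRankZeroOneCyclotomicThree.exists_padicVal_shaOrder_add_le K V W hPR hGZK hmod hMilne C hC
    hord hadd hrV hrW hf ϖ ϖ' hϖ hϖ' Dh hDh (hcert Dm.f hf) (fun κ γ hκ hγ hγ' D ↦ ?_)
    (XGordRankZeroOneCyclotomicThree.schneiderK_of_fact K V hS1 hord)
  exact hKato V K (V.baseChange K) hord hsurjV ⟨1, one_smul _ _⟩ hκ hγ hγ' hf D ϖ ϖ' hϖ hϖ'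

/-! ## §3 The typed upper half for `W` and `BSD₃` on both curves on the doubly-unit rows -/

/-- **X3, ranks `(0,1)`: `BSD(W,3) ∧ BSD(V,3)` on the doubly-unit rows, from named facts + the
certificate.** If moreover `#Ш_an(V)` and `#Ш_an(W)` are `3`-adic units then Miller's `BSD(W,3)` (the
additive X3 pair of analytic rank `0`) and `BSD(V,3)` (its good ordinary Eisenstein twist pair of
analytic rank ONE — an X1 `r = 1` pair) hold. Census: 73 of the 74 CORE-open X3 rows. Labels UNCHANGED;
nothing booked. [cite: Wuthrich2014, Thm. 16 (p. 397)] [cite: GreenbergLNM1716, §4 p. 110]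
[cite: PerrinRiou1987, §1.4 Cor. 1.8] [cite: Miller2011LMS, §1 and Def. 1.1] -/
theorem X3GordRankZeroOneCyclotomicThree.bsdp_of_shaAn_units_of_facts
    (hW16 : Wuthrich2014.charIdeal_dvd_padicLFunction_cyclotomicThree)
    (hS1 : Greenberg1999.schneider_charCoeff_rankOne_quadraticBaseChange)
    (hPR : perrinRiou_rankOne_leadingTerms_odd) (hMT : mazur_tate_sigma_exists_odd)
    (hMilne : Milne1972.bsdQuotient_baseChange_quadratic_anyModel)
    (hGZK : rank_eq_analyticRank_of_analyticRank_le_one) (hmod : hasEntireLFunction_rat)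
    (hmodD : nonempty_modularParametrizationData)
    (C : VariableChange ℚ) (hC : C • V.quadraticTwist (-(3 : ℚ)) = W)
    (hord : IsOrdinaryAt V 3) (hred : ¬ V.HasIrreducibleModPGaloisRep 3) (hadd : Addv W 3)
    (hrV : V.analyticRank = 1) (hrW : W.analyticRank = 0)
    (hcert : ∀ {N : ℕ} [NeZero N] (f : CuspForm (Gamma0 N) 2), IsNewformOf V f →
      PowerSeries.coeff 1 (padicLFunction f ((unitRoot V 3 : ℤ_[3]) : ℚ_[3])) ≠ 0)
    {qV qW : ℚ} (hqV : shaAn V = (qV : ℂ)) (hqW : shaAn W = (qW : ℂ))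
    (hvV : padicValRat 3 qV = 0) (hvW : padicValRat 3 qW = 0) : BSDp W 3 ∧ BSDp V 3 := by
  obtain ⟨qV', qW', hqV', hqW', hle⟩ :=
    X3GordRankZeroOneCyclotomicThree.exists_padicVal_shaOrder_add_le_of_facts V W hW16 hS1 hPR hMT hMilne
      hGZK hmod hmodD C hC hord hred hadd hrV hrW hcert
  have hqq : qV' = qV := by exact_mod_cast hqV'.symm.trans hqV
  have hqq' : qW' = qW := by exact_mod_cast hqW'.symm.trans hqW
  subst hqq hqq'
  rw [hvV, hvW, add_zero] at hle
  have hV0 : (0 : ℤ) ≤ padicValNat 3 V.shaOrder := by positivity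
  have hW0 : (0 : ℤ) ≤ padicValNat 3 W.shaOrder := by positivity
  have huW : MissingUpperBoundAt W 3 := ⟨qW', hqW', by rw [hvW]; linarith⟩
  have huV : MissingUpperBoundAt V 3 := ⟨qV', hqV', by rw [hvV]; linarith⟩
  exact ⟨bsdp_of_missingPPartAt W 3 hGZK (by rw [hrW]; exact zero_le_one)
      (missingPPartAt_of_upper_of_shaAn_unit W 3 huW hqW' hvW),
    bsdp_of_missingPPartAt V 3 hGZK (by rw [hrV])
      (missingPPartAt_of_upper_of_shaAn_unit V 3 huV hqV' hvV)⟩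

/-- **X3, ranks `(0,1)`: the cell's typed UPPER half for the additive curve** — if `#Ш_an(V)` has
non-positive `3`-adic valuation (census: `3 ∤ #Ш_an(V)` on every row) then `Typed.MissingUpperBoundAt W 3`;
with a `3`-descent certificate and Cassels–Tate this closes the `3 ∣ #Ш_an(W)` row (819e1-type) too.
[cite: Wuthrich2014, Thm. 16 (p. 397)] [cite: GreenbergLNM1716, §4 p. 110] -/
theorem X3GordRankZeroOneCyclotomicThree.missingUpperBoundAt_of_facts
    (hW16 : Wuthrich2014.charIdeal_dvd_padicLFunction_cyclotomicThree)
    (hS1 : Greenberg1999.schneider_charCoeff_rankOne_quadraticBaseChange)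
    (hPR : perrinRiou_rankOne_leadingTerms_odd) (hMT : mazur_tate_sigma_exists_odd)
    (hMilne : Milne1972.bsdQuotient_baseChange_quadratic_anyModel)
    (hGZK : rank_eq_analyticRank_of_analyticRank_le_one) (hmod : hasEntireLFunction_rat)
    (hmodD : nonempty_modularParametrizationData)
    (C : VariableChange ℚ) (hC : C • V.quadraticTwist (-(3 : ℚ)) = W)
    (hord : IsOrdinaryAt V 3) (hred : ¬ V.HasIrreducibleModPGaloisRep 3) (hadd : Addv W 3)
    (hrV : V.analyticRank = 1) (hrW : W.analyticRank = 0)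
    (hcert : ∀ {N : ℕ} [NeZero N] (f : CuspForm (Gamma0 N) 2), IsNewformOf V f →
      PowerSeries.coeff 1 (padicLFunction f ((unitRoot V 3 : ℤ_[3]) : ℚ_[3])) ≠ 0)
    {qV : ℚ} (hqV : shaAn V = (qV : ℂ)) (hv : padicValRat 3 qV ≤ 0) :
    MissingUpperBoundAt W 3 := by
  obtain ⟨qV', qW, hqV', hqW, hle⟩ :=
    X3GordRankZeroOneCyclotomicThree.exists_padicVal_shaOrder_add_le_of_facts V W hW16 hS1 hPR hMT hMilne
      hGZK hmod hmodD C hC hord hred hadd hrV hrW hcert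
  have hqq : qV' = qV := by exact_mod_cast hqV'.symm.trans hqV
  subst hqq
  refine ⟨qW, hqW, ?_⟩
  have h0 : (0 : ℤ) ≤ padicValNat 3 V.shaOrder := by positivity
  linarith

/-- **X4, ranks `(0,1)`: `BSD(W,3) ∧ BSD(V,3)` on the doubly-unit rows with `surj(3) ∧ ram(3)`, from
named facts + the certificate.** Census: 68 of the 75 CORE-open X4 rows (2 more have `3 ∣ #Ш_an(W)`,
5 lack a `ram` prime). `(V,3)` is an irreducible good ordinary rank-ONE pair at `p = 3` (X10-type).
Labels UNCHANGED; nothing booked. [cite: Kato2004Asterisque, Thm. 17.4 (3) (p. 273)]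
[cite: GreenbergLNM1716, §4 p. 110] [cite: PerrinRiou1987, §1.4 Cor. 1.8] [cite: Miller2011LMS, §1 and Def. 1.1] -/
theorem X4GordRankZeroOneCyclotomicThree.bsdp_of_shaAn_units_of_surj_of_ram
    (hKato : Kato2004.charIdeal_dvd_padicLFunction_cyclotomicThree_of_surjective)
    (hS1 : Greenberg1999.schneider_charCoeff_rankOne_quadraticBaseChange)
    (hPR : perrinRiou_rankOne_leadingTerms_odd) (hMT : mazur_tate_sigma_exists_odd)
    (hMilne : Milne1972.bsdQuotient_baseChange_quadratic_anyModel)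
    (hGZK : rank_eq_analyticRank_of_analyticRank_le_one) (hmod : hasEntireLFunction_rat)
    (hmodD : nonempty_modularParametrizationData)
    (C : VariableChange ℚ) (hC : C • V.quadraticTwist (-(3 : ℚ)) = W)
    (hord : IsOrdinaryAt V 3) (hsurj : Surj W 3) (hram : Ram W 3) (hadd : Addv W 3)
    (hrV : V.analyticRank = 1) (hrW : W.analyticRank = 0)
    (hcert : ∀ {N : ℕ} [NeZero N] (f : CuspForm (Gamma0 N) 2), IsNewformOf V f →
      PowerSeries.coeff 1 (padicLFunction f ((unitRoot V 3 : ℤ_[3]) : ℚ_[3])) ≠ 0)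
    {qV qW : ℚ} (hqV : shaAn V = (qV : ℂ)) (hqW : shaAn W = (qW : ℂ))
    (hvV : padicValRat 3 qV = 0) (hvW : padicValRat 3 qW = 0) : BSDp W 3 ∧ BSDp V 3 := by
  obtain ⟨qV', qW', hqV', hqW', hle⟩ :=
    X4GordRankZeroOneCyclotomicThree.exists_padicVal_shaOrder_add_le_of_surj_of_ram V W hKato hS1 hPR hMT
      hMilne hGZK hmod hmodD C hC hord hsurj hram hadd hrV hrW hcert
  have hqq : qV' = qV := by exact_mod_cast hqV'.symm.trans hqV
  have hqq' : qW' = qW := by exact_mod_cast hqW'.symm.trans hqW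
  subst hqq hqq'
  rw [hvV, hvW, add_zero] at hle
  have hV0 : (0 : ℤ) ≤ padicValNat 3 V.shaOrder := by positivity
  have hW0 : (0 : ℤ) ≤ padicValNat 3 W.shaOrder := by positivity
  have huW : MissingUpperBoundAt W 3 := ⟨qW', hqW', by rw [hvW]; linarith⟩
  have huV : MissingUpperBoundAt V 3 := ⟨qV', hqV', by rw [hvV]; linarith⟩
  exact ⟨bsdp_of_missingPPartAt W 3 hGZK (by rw [hrW]; exact zero_le_one)
      (missingPPartAt_of_upper_of_shaAn_unit W 3 huW hqW' hvW),
    bsdp_of_missingPPartAt V 3 hGZK (by rw [hrV])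
      (missingPPartAt_of_upper_of_shaAn_unit V 3 huV hqV' hvV)⟩

/-- **X4, ranks `(0,1)`: the cell's typed UPPER half for the additive curve** (`surj(3) ∧ ram(3)`),
under `ord₃ #Ш_an(V) ≤ 0`. [cite: Kato2004Asterisque, Thm. 17.4 (3) (p. 273)] [cite: GreenbergLNM1716, §4 p. 110] -/
theorem X4GordRankZeroOneCyclotomicThree.missingUpperBoundAt_of_surj_of_ram
    (hKato : Kato2004.charIdeal_dvd_padicLFunction_cyclotomicThree_of_surjective)
    (hS1 : Greenberg1999.schneider_charCoeff_rankOne_quadraticBaseChange)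
    (hPR : perrinRiou_rankOne_leadingTerms_odd) (hMT : mazur_tate_sigma_exists_odd)
    (hMilne : Milne1972.bsdQuotient_baseChange_quadratic_anyModel)
    (hGZK : rank_eq_analyticRank_of_analyticRank_le_one) (hmod : hasEntireLFunction_rat)
    (hmodD : nonempty_modularParametrizationData)
    (C : VariableChange ℚ) (hC : C • V.quadraticTwist (-(3 : ℚ)) = W)
    (hord : IsOrdinaryAt V 3) (hsurj : Surj W 3) (hram : Ram W 3) (hadd : Addv W 3)
    (hrV : V.analyticRank = 1) (hrW : W.analyticRank = 0)
    (hcert : ∀ {N : ℕ} [NeZero N] (f : CuspForm (Gamma0 N) 2), IsNewformOf V f →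
      PowerSeries.coeff 1 (padicLFunction f ((unitRoot V 3 : ℤ_[3]) : ℚ_[3])) ≠ 0)
    {qV : ℚ} (hqV : shaAn V = (qV : ℂ)) (hv : padicValRat 3 qV ≤ 0) :
    MissingUpperBoundAt W 3 := by
  obtain ⟨qV', qW, hqV', hqW, hle⟩ :=
    X4GordRankZeroOneCyclotomicThree.exists_padicVal_shaOrder_add_le_of_surj_of_ram V W hKato hS1 hPR hMT
      hMilne hGZK hmod hmodD C hC hord hsurj hram hadd hrV hrW hcert
  have hqq : qV' = qV := by exact_mod_cast hqV'.symm.trans hqV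
  subst hqq
  refine ⟨qW, hqW, ?_⟩
  have h0 : (0 : ℤ) ≤ padicValNat 3 V.shaOrder := by positivity
  linarith

end Facts

end Summit.BirchSwinnertonDyer.Rank1Residual.Additive

end
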